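import Summits.AtomisticToContinuum.FouriersLaw.Theorems.LatticeLandauDampingAbelThermodynamicLimitUniformAnchoredCorrelationTailsPropagation
import Summits.AtomisticToContinuum.FouriersLaw.Theorems.LatticeLandauDampingAbelThermodynamicLimitUniformAnchoredCorrelationTailsSiteTails
import Summits.AtomisticToContinuum.FouriersLaw.Theorems.JunctionLocalityNonBallisticLightConeAssemblyPart2e

/-!
# The weighted single-flip estimate of the synchronous coupling (light cone of (C′), fixed `N`)

Helper (`--supports stmt-AtomisticToContinuum-14013`) for the line `series-law-at-every-laplace-frequency`
(SketchIdeator2) of the crux `LatticeLandauDamping.AbelThermodynamicLimit`, stub (C′)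
`stub_uniformAnchoredCorrelationTails`. Registered sub-goal `pinnedChain_singleFlip_weighted_estimate`.

For ONE flipped momentum `i₀` and a genuine bond `(k, k+1)` at distance `≥ D ≥ 1` from `i₀`, at a fixed `N`, this file
bounds the pathwise mean square `∫⁻ x, ∫⁻ ω, (j_k(Φ_s(Θ_{i₀}x, Bω)) − j_k(Φ_s(x, Bω)))² dW dμ_T` by

  `28224 (1+β)² ρ⁶ (9/16)^D (195T² + 32) + 4√(C₄ · 2b)`

given: a scale `ρ ≥ 1` in the light-cone regime `2e·3(Aρ²)√(1+2n) τ ≤ n` for all `n ≥ D`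
(`A = 3 + ω₂ + 3 lam + 24β + 2γ`), a measurable exceptional set `E` of `μ_T ⊗ W`-measure `≤ b` off which the WEIGHTED
position box `q_{j'}(Φ_r x)² ≤ ρ² √(1 + |j − i₀|)` (`|j' − j| ≤ 1`) holds on `[0, τ]`, and `∫ j_k⁴ dμ_T ≤ C₄`. On the good
event (neither `x` nor `Θ_{i₀}x` exceptional) the weighted propagation bound `chainFlow_momentumFlip_propagation_weighted`
and the local Lipschitz bound of the current give `Δ² ≤ d (p_{i₀}⁴/2 + (1+|p_k|+|p_{k+1}|)⁴/2)`, `d = 28224(1+β)²ρ⁶(9/16)^D`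
(the local box radius `R² = ρ²√(1+n)` at the target, `n = |k − i₀| ≥ D`, is paid by the decay:
`R⁶ 4^{-n} ≤ ρ⁶ ((1+n)2^{-n})² ≤ 4ρ⁶ (9/16)^n`, Bernoulli); on the bad event `Δ² ≤ 2j̃² + 2j²` and Hölder. The terms are
those of the landed assembly of the `NonBallistic` light-cone window (parts 2b–2e), whose global box is replaced by
the weighted one. Folklore; no definitions.
-/

noncomputable section

open MeasureTheory ProbabilityTheory Set Filter Topology
open scoped NNReal ENNReal

namespace Summit.AtomisticToContinuum.FouriersLaw.Theorems.AbelThermodynamicLimit.SeriesLawAtEveryLaplaceFrequency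

open Literature.MathematicalPhysics.KineticTheory Literature.MathematicalPhysics.KineticTheory.HeatConduction
open Literature.Probability.Process OscillatorChain
open Summit.AtomisticToContinuum.FouriersLaw.Theorems.NonBallistic
open Summit.AtomisticToContinuum.FouriersLaw.Theorems.NonBallistic.FSAssembly

namespace SingleFlip

/-! ### Elementary decay bookkeeping -/

/-- Bernoulli: `(1 + n)(1/2)^n ≤ 2(3/4)^n` (`(3/2)^n ≥ 1 + n/2`). [folklore] -/
theorem one_add_mul_half_pow_le (n : ℕ) : (1 + (n : ℝ)) * (1 / 2) ^ n ≤ 2 * (3 / 4) ^ n := by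
  have hB : 1 + (n : ℝ) * (1 / 2) ≤ (1 + 1 / 2) ^ n := one_add_mul_le_pow (by norm_num) n
  have e : (3 / 4 : ℝ) ^ n = (1 + 1 / 2) ^ n * (1 / 2) ^ n := by rw [← mul_pow]; norm_num
  rw [e]
  have h0 : (0 : ℝ) ≤ (1 / 2) ^ n := by positivity
  nlinarith [mul_le_mul_of_nonneg_right hB h0]

/-- The local box radius at the target is paid by the decay: for `R² = ρ²√(1+n)`, `D ≤ n`,
`R⁶ (1/4)^n ≤ 4ρ⁶ (9/16)^D`. [folklore] -/
theorem radius_pow_six_mul_le {ρ R : ℝ} {n D : ℕ} (hDn : D ≤ n) (hR : R ^ 2 = ρ ^ 2 * Real.sqrt (1 + (n : ℝ))) :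
    R ^ 6 * ((1 / 2 : ℝ) ^ n) ^ 2 ≤ 4 * ρ ^ 6 * (9 / 16) ^ D := by
  have hn : (0 : ℝ) ≤ n := n.cast_nonneg
  have hs1 : Real.sqrt (1 + (n : ℝ)) ≤ 1 + n := by
    rw [Real.sqrt_le_left (by linarith)]; nlinarith
  have hs0 : 0 ≤ Real.sqrt (1 + (n : ℝ)) := Real.sqrt_nonneg _
  have hR6 : R ^ 6 ≤ ρ ^ 6 * (1 + n) ^ 2 := by
    have e : R ^ 6 = (R ^ 2) ^ 3 := by ring
    rw [e, hR, mul_pow]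
    have h3 : Real.sqrt (1 + (n : ℝ)) ^ 3 ≤ (1 + (n : ℝ)) ^ 2 :=
      calc Real.sqrt (1 + (n : ℝ)) ^ 3 = Real.sqrt (1 + (n : ℝ)) ^ 2 * Real.sqrt (1 + (n : ℝ)) := by ring
        _ = (1 + n) * Real.sqrt (1 + (n : ℝ)) := by rw [Real.sq_sqrt (by linarith)]
        _ ≤ (1 + n) * (1 + n) := mul_le_mul_of_nonneg_left hs1 (by linarith)
        _ = (1 + (n : ℝ)) ^ 2 := by ring
    have e6 : (ρ ^ 2) ^ 3 = ρ ^ 6 := by ring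
    rw [e6]
    exact mul_le_mul_of_nonneg_left h3 (by positivity)
  have hb := one_add_mul_half_pow_le n
  have hdec : ((9 / 16 : ℝ)) ^ n ≤ (9 / 16) ^ D := pow_le_pow_of_le_one (by norm_num) (by norm_num) hDn
  have h0 : 0 ≤ (1 + (n : ℝ)) * (1 / 2) ^ n := by positivity
  calc R ^ 6 * ((1 / 2 : ℝ) ^ n) ^ 2 ≤ ρ ^ 6 * (1 + n) ^ 2 * ((1 / 2 : ℝ) ^ n) ^ 2 :=
        mul_le_mul_of_nonneg_right hR6 (by positivity)
    _ = ρ ^ 6 * ((1 + (n : ℝ)) * (1 / 2) ^ n) ^ 2 := by ring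
    _ ≤ ρ ^ 6 * (2 * (3 / 4) ^ n) ^ 2 := mul_le_mul_of_nonneg_left (pow_le_pow_left₀ h0 hb 2) (by positivity)
    _ = 4 * ρ ^ 6 * (9 / 16) ^ n := by rw [mul_pow, ← pow_mul, pow_mul']; norm_num; ring
    _ ≤ 4 * ρ ^ 6 * (9 / 16) ^ D := mul_le_mul_of_nonneg_left hdec (by positivity)

/-! ### The deterministic core on the good event -/

variable {ω₂ lam β γ : ℝ}

/-- **The weighted cone bound for the current.** Positions near every site `j` of both flows obey the weighted box
`q² ≤ ρ²√(1+|j−i₀|)` on `[0, τ]`, the regime `2e·3(Aρ²)√(1+2n)τ ≤ n` holds for all `n ≥ D`, and the bond `(k,k+1)`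
(`k+1 < N`) is at distance `≥ D ≥ 1` from `i₀`; then at every `s ∈ [0, τ]`
`(j_k(Φ_s(Θ_{i₀}x)) − j_k(Φ_s x))² ≤ 28224(1+β)²ρ⁶(9/16)^D · p_{i₀}(x)² (1 + |p_k(Φ_s x)| + |p_{k+1}(Φ_s x)|)²`. [folklore] -/
theorem sq_bondCurrent_diff_le_weighted (hω : 0 < ω₂) (hl : 0 ≤ lam) (hβ : 0 ≤ β) (hγ : 0 ≤ γ) {N : ℕ}
    (i₀ k : Fin N) (hk : k.val + 1 < N) {D : ℕ} (hD1 : 1 ≤ D) (hDk : D ≤ (((k : ℕ) : ℤ) - i₀).natAbs)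
    (hDk1 : D ≤ (((k : ℕ) : ℤ) + 1 - i₀).natAbs) (x : PhaseSpace N) {η : ℝ → Fin N → ℝ} (hη : Continuous η)
    {ρ τ : ℝ} (hρ : 1 ≤ ρ)
    (hreg : ∀ n : ℕ, D ≤ n →
      2 * Real.exp 1 * (3 * ((3 + ω₂ + 3 * lam + 24 * β + 2 * γ) * ρ ^ 2) * Real.sqrt (1 + ((2 * n : ℕ) : ℝ)) * τ) ≤ n)
    (hbox : ∀ s ∈ Set.Icc 0 τ, ∀ j j' : Fin N, (((j' : ℕ) : ℤ) - j).natAbs ≤ 1 →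
      ((pinnedChain ω₂ lam β γ).chainFlow N x η s).1 j' ^ 2 ≤ ρ ^ 2 * Real.sqrt (1 + ((((j : ℕ) : ℤ) - i₀).natAbs : ℝ)) ∧
      ((pinnedChain ω₂ lam β γ).chainFlow N (momentumFlip i₀ x) η s).1 j' ^ 2 ≤
        ρ ^ 2 * Real.sqrt (1 + ((((j : ℕ) : ℤ) - i₀).natAbs : ℝ)))
    {s : ℝ} (hs : s ∈ Set.Icc 0 τ) :
    ((pinnedChain ω₂ lam β γ).bondCurrent N k ((pinnedChain ω₂ lam β γ).chainFlow N (momentumFlip i₀ x) η s) -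
        (pinnedChain ω₂ lam β γ).bondCurrent N k ((pinnedChain ω₂ lam β γ).chainFlow N x η s)) ^ 2 ≤
      28224 * (1 + β) ^ 2 * ρ ^ 6 * (9 / 16) ^ D *
        ((x.2 i₀) ^ 2 * (1 + |((pinnedChain ω₂ lam β γ).chainFlow N x η s).2 k| +
          |((pinnedChain ω₂ lam β γ).chainFlow N x η s).2 ⟨k.val + 1, hk⟩|) ^ 2) := by
  set P := pinnedChain ω₂ lam β γ with hP
  set k1 : Fin N := ⟨k.val + 1, hk⟩ with hk1
  set z : PhaseSpace N := P.chainFlow N x η s with hz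
  set z' : PhaseSpace N := P.chainFlow N (momentumFlip i₀ x) η s with hz'
  set n : ℕ := (((k : ℕ) : ℤ) - i₀).natAbs with hn
  set n1 : ℕ := (((k1 : ℕ) : ℤ) - i₀).natAbs with hn1
  have hn1' : n1 = (((k : ℕ) : ℤ) + 1 - i₀).natAbs := by simp [hn1, hk1]
  have hDn : D ≤ n := hDk
  have hDn1 : D ≤ n1 := by rw [hn1']; exact hDk1
  have hki : k ≠ i₀ := fun h => by rw [h] at hn; simp at hn; omega
  have hk1i : k1 ≠ i₀ := fun h => by rw [h] at hn1; simp at hn1; omega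
  have hρ0 : 0 ≤ ρ := le_trans zero_le_one hρ
  -- the weight and its admissibility
  set g : ℕ → ℝ := fun m => Real.sqrt (1 + (m : ℝ)) with hg
  have hg1 : ∀ m, 1 ≤ g m := fun m => BoxTail.weight_one_le m
  have hgm : Monotone g := BoxTail.weight_monotone
  have hg3 : ∀ m : ℕ, g m ≤ 3 + m := fun m => BoxTail.weight_le m
  have hg4 : ∀ m m' : ℕ, 1 ≤ m → m ≤ m' → (m : ℝ) * g (2 * m') ≤ m' * g (2 * m) := fun m m' h1 h2 =>
    BoxTail.weight_antitone m m' h1 h2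
  -- box on `[0, s]`
  have hboxs : ∀ u ∈ Set.Icc 0 s, ∀ j j' : Fin N, ((j' : ℤ) - j).natAbs ≤ 1 →
      (P.chainFlow N x η u).1 j' ^ 2 ≤ ρ ^ 2 * g ((j : ℤ) - i₀).natAbs ∧
      (P.chainFlow N (momentumFlip i₀ x) η u).1 j' ^ 2 ≤ ρ ^ 2 * g ((j : ℤ) - i₀).natAbs :=
    fun u hu j j' hjj' => hbox u ⟨hu.1, hu.2.trans hs.2⟩ j j' hjj'
  -- regime at the two sites, at time `s ≤ τ`
  have hregs : ∀ m : ℕ, D ≤ m →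
      2 * Real.exp 1 * (3 * ((3 + ω₂ + 3 * lam + 24 * β + 2 * γ) * ρ ^ 2) * g (2 * m) * s) ≤ m := by
    intro m hm
    refine le_trans ?_ (hreg m hm)
    have h0 : 0 ≤ 2 * Real.exp 1 * (3 * ((3 + ω₂ + 3 * lam + 24 * β + 2 * γ) * ρ ^ 2) * g (2 * m)) := by
      have := hg1 (2 * m); positivity
    have h1 := mul_le_mul_of_nonneg_left hs.2 h0
    have e1 : 2 * Real.exp 1 * (3 * ((3 + ω₂ + 3 * lam + 24 * β + 2 * γ) * ρ ^ 2) * g (2 * m) * s) =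
        2 * Real.exp 1 * (3 * ((3 + ω₂ + 3 * lam + 24 * β + 2 * γ) * ρ ^ 2) * g (2 * m)) * s := by ring
    have e2 : 2 * Real.exp 1 * (3 * ((3 + ω₂ + 3 * lam + 24 * β + 2 * γ) * ρ ^ 2) *
        Real.sqrt (1 + ((2 * m : ℕ) : ℝ)) * τ) =
        2 * Real.exp 1 * (3 * ((3 + ω₂ + 3 * lam + 24 * β + 2 * γ) * ρ ^ 2) * g (2 * m)) * τ := by
      simp only [hg]; ring
    rw [e1, e2]
    exact h1
  -- the two propagation bounds
  have huk := WeightedPropagation.propagation_weighted hω hl hβ hγ hg1 hgm hg3 hg4 N i₀ x hη hρ hs.1 hboxs hki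
    (hregs n hDn)
  have huk1 := WeightedPropagation.propagation_weighted hω hl hβ hγ hg1 hgm hg3 hg4 N i₀ x hη hρ hs.1 hboxs hk1i
    (hregs n1 hDn1)
  rw [← hn] at huk
  rw [← hn1] at huk1
  -- `(1/2)^{n1} ≤ 2 (1/2)^n`
  have hn1n : n - 1 ≤ n1 := by simp only [hn, hn1, hk1]; omega
  have hhalf : (1 / 2 : ℝ) ^ n1 ≤ 2 * (1 / 2) ^ n := by
    calc (1 / 2 : ℝ) ^ n1 ≤ (1 / 2) ^ (n - 1) := pow_le_pow_of_le_one (by norm_num) (by norm_num) hn1n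
      _ = 2 * (1 / 2) ^ n := by
          obtain ⟨m, hm⟩ : ∃ m, n = m + 1 := ⟨n - 1, by omega⟩
          rw [hm, Nat.add_sub_cancel, pow_succ]; ring
  have hsum : |z'.1 k - z.1 k| + |z'.2 k - z.2 k| + |z'.1 k1 - z.1 k1| + |z'.2 k1 - z.2 k1| ≤
      12 * |x.2 i₀| * (1 / 2) ^ n := by
    have h1 : |z'.1 k1 - z.1 k1| + |z'.2 k1 - z.2 k1| ≤ 2 * (2 * |x.2 i₀|) * (2 * (1 / 2) ^ n) :=
      huk1.trans (mul_le_mul_of_nonneg_left hhalf (by positivity))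
    have h2 : |z'.1 k - z.1 k| + |z'.2 k - z.2 k| ≤ 2 * (2 * |x.2 i₀|) * (1 / 2) ^ n := huk
    nlinarith [h1, h2]
  -- the local box at the target
  set R : ℝ := Real.sqrt (ρ ^ 2 * g n) with hR
  have hRg : R ^ 2 = ρ ^ 2 * Real.sqrt (1 + (n : ℝ)) := Real.sq_sqrt (by have := hg1 n; positivity)
  have hR1 : 1 ≤ R := by
    have h1 : 1 ≤ ρ ^ 2 * g n := by nlinarith [hg1 n, one_le_pow₀ (n := 2) hρ]
    have h2 : Real.sqrt 1 ≤ Real.sqrt (ρ ^ 2 * g n) := Real.sqrt_le_sqrt h1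
    rwa [Real.sqrt_one, ← hR] at h2
  have hkk : (((k : ℕ) : ℤ) - k).natAbs ≤ 1 := by simp
  have hk1k : (((k1 : ℕ) : ℤ) - k).natAbs ≤ 1 := by simp [hk1]
  have habs : ∀ {q : ℝ}, q ^ 2 ≤ ρ ^ 2 * g n → |q| ≤ R := fun h => by
    rw [← Real.sqrt_sq_eq_abs, hR]; exact Real.sqrt_le_sqrt h
  obtain ⟨bk, bk'⟩ := hbox s hs k k hkk
  obtain ⟨bk1, bk1'⟩ := hbox s hs k k1 hk1k
  have hL := abs_bondCurrent_sub_le (ω₂ := ω₂) (lam := lam) (γ := γ) hβ k hk hR1 z z' (habs bk) (habs bk1) (habs bk')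
    (habs bk1')
  -- collect
  set S := 1 + |z.2 k| + |z.2 k1| with hS
  have hS0 : 0 ≤ S := by positivity
  have hmain : |P.bondCurrent N k z' - P.bondCurrent N k z| ≤ 7 * (1 + β) * R ^ 3 * S * (12 * |x.2 i₀| * (1 / 2) ^ n) :=
    hL.trans (mul_le_mul_of_nonneg_left hsum (by positivity))
  have hdec := radius_pow_six_mul_le hDn hRg
  have hR0 : 0 ≤ R := le_trans zero_le_one hR1
  calc (P.bondCurrent N k z' - P.bondCurrent N k z) ^ 2 = |P.bondCurrent N k z' - P.bondCurrent N k z| ^ 2 := (sq_abs _).symm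
    _ ≤ (7 * (1 + β) * R ^ 3 * S * (12 * |x.2 i₀| * (1 / 2) ^ n)) ^ 2 := pow_le_pow_left₀ (abs_nonneg _) hmain 2
    _ = 7056 * (1 + β) ^ 2 * (R ^ 6 * ((1 / 2 : ℝ) ^ n) ^ 2) * ((x.2 i₀) ^ 2 * S ^ 2) := by rw [← sq_abs (x.2 i₀)]; ring
    _ ≤ 7056 * (1 + β) ^ 2 * (4 * ρ ^ 6 * (9 / 16) ^ D) * ((x.2 i₀) ^ 2 * S ^ 2) :=
        mul_le_mul_of_nonneg_right (mul_le_mul_of_nonneg_left hdec (by positivity)) (by positivity)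
    _ = 28224 * (1 + β) ^ 2 * ρ ^ 6 * (9 / 16) ^ D * ((x.2 i₀) ^ 2 * S ^ 2) := by ring

/-! ### The single-flip estimate at a fixed `N` -/

variable (hω : 0 < ω₂) (hl : 0 < lam) (hβ : 0 < β) (hγ : 0 < γ) {N : ℕ} {T : ℝ} (hT : 0 < T)

include hω hl hβ hγ hT in
/-- **The weighted single-flip estimate.** See the module docstring: with the exceptional set `E` (measure `≤ b`,
weighted box off `E` on `[0, τ]`), the regime for all `n ≥ D`, the distance conditions and `∫ j_k⁴ dμ_T ≤ C₄`, for
every `s ≤ τ`: `∫⁻ x, ∫⁻ ω, (j_k(Φ_s(Θ_{i₀}x)) − j_k(Φ_s x))² ≤ 28224(1+β)²ρ⁶(9/16)^D(195T²+32) + 4√(C₄ · 2b)`. [folklore] -/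
theorem single_flip_weighted (i₀ k : Fin N) (hk : k.val + 1 < N) {D : ℕ} (hD1 : 1 ≤ D)
    (hDk : D ≤ (((k : ℕ) : ℤ) - i₀).natAbs) (hDk1 : D ≤ (((k : ℕ) : ℤ) + 1 - i₀).natAbs) {ρ τ : ℝ} (hρ : 1 ≤ ρ)
    (hreg : ∀ n : ℕ, D ≤ n →
      2 * Real.exp 1 * (3 * ((3 + ω₂ + 3 * lam + 24 * β + 2 * γ) * ρ ^ 2) * Real.sqrt (1 + ((2 * n : ℕ) : ℝ)) * τ) ≤ n)
    (E : Set (PhaseSpace N × WienerPair)) (hEm : MeasurableSet E) {b : ℝ} (hb : 0 ≤ b)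
    (hEπ : (((pinnedChain ω₂ lam β γ).gibbsMeasure N T).prod wienerPair) E ≤ ENNReal.ofReal b)
    (hbox : ∀ q ∉ E, ∀ s ∈ Set.Icc (0:ℝ) τ, ∀ j j' : Fin N, (((j' : ℕ) : ℤ) - j).natAbs ≤ 1 →
      ((pinnedChain ω₂ lam β γ).solMap N T T s q.1 (pairPath q.2)).1 j' ^ 2 ≤
        ρ ^ 2 * Real.sqrt (1 + ((((j : ℕ) : ℤ) - i₀).natAbs : ℝ)))
    {C₄ : ℝ} (hC₄ : 0 ≤ C₄)
    (hD2 : Integrable (fun x => (pinnedChain ω₂ lam β γ).bondCurrent N k x ^ 4) ((pinnedChain ω₂ lam β γ).gibbsMeasure N T) ∧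
      ∫ x, (pinnedChain ω₂ lam β γ).bondCurrent N k x ^ 4 ∂((pinnedChain ω₂ lam β γ).gibbsMeasure N T) ≤ C₄)
    (s : ℝ≥0) (hs : (s : ℝ) ≤ τ) :
    ∫⁻ x, ∫⁻ ω, ENNReal.ofReal
        (((pinnedChain ω₂ lam β γ).bondCurrent N k
            ((pinnedChain ω₂ lam β γ).solMap N T T s (momentumFlip i₀ x) (pairPath ω)) -
          (pinnedChain ω₂ lam β γ).bondCurrent N k ((pinnedChain ω₂ lam β γ).solMap N T T s x (pairPath ω))) ^ 2)
        ∂wienerPair ∂((pinnedChain ω₂ lam β γ).gibbsMeasure N T) ≤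
      ENNReal.ofReal (28224 * (1 + β) ^ 2 * ρ ^ 6 * (9 / 16) ^ D * (195 * T ^ 2 + 32)) +
        ENNReal.ofReal (4 * Real.sqrt (C₄ * (2 * b))) := by
  -- adapted from `NonBallistic.FSAssembly.single_flip_estimate` (global box there, weighted box here)
  set P := pinnedChain ω₂ lam β γ with hP
  set μ := P.gibbsMeasure N T with hμ
  haveI hμP : IsProbabilityMeasure μ := pinnedChain_isProbabilityMeasure_gibbsMeasure hω hl.le hβ.le γ N hT
  have hN0 : 0 < N := by omega
  set k1 : Fin N := ⟨k.val + 1, hk⟩ with hk1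
  set d : ℝ := 28224 * (1 + β) ^ 2 * ρ ^ 6 * (9 / 16) ^ D with hd
  have hd0 : 0 ≤ d := by have := le_trans zero_le_one hρ; positivity
  have hzm : Measurable fun q : PhaseSpace N × WienerPair => P.solMap N T T s q.1 (pairPath q.2) :=
    pinnedChain_measurable_solMap_pairPath hω hl.le hβ.le hγ.le N T T s
  set Θ : PhaseSpace N × WienerPair → PhaseSpace N × WienerPair := fun q => (momentumFlip i₀ q.1, q.2) with hΘ
  have hΘm : Measurable Θ := ((measurable_momentumFlip i₀).comp measurable_fst).prodMk measurable_snd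
  have hz'm : Measurable fun q : PhaseSpace N × WienerPair => P.solMap N T T s (momentumFlip i₀ q.1) (pairPath q.2) := by
    have h := hzm.comp hΘm
    exact h
  have hjm : Measurable (P.bondCurrent N k) := (pinnedChain_continuous_bondCurrent ω₂ lam β γ N k).measurable
  set J : PhaseSpace N × WienerPair → ℝ := fun q => P.bondCurrent N k (P.solMap N T T s q.1 (pairPath q.2)) with hJ
  set J' : PhaseSpace N × WienerPair → ℝ := fun q =>
    P.bondCurrent N k (P.solMap N T T s (momentumFlip i₀ q.1) (pairPath q.2)) with hJ'
  have hJm : Measurable J := by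
    have h := hjm.comp hzm
    exact h
  have hJ'm : Measurable J' := by
    have h := hjm.comp hz'm
    exact h
  set g₂ : PhaseSpace N → ℝ := fun z => (1 + |z.2 k| + |z.2 k1|) ^ 4 / 2 with hg₂
  have hg₂m : Measurable g₂ := by
    have h1 : Measurable fun z : PhaseSpace N => z.2 k := (measurable_pi_apply k).comp measurable_snd
    have h2 : Measurable fun z : PhaseSpace N => z.2 k1 := (measurable_pi_apply k1).comp measurable_snd
    exact (((measurable_const.add h1.abs).add h2.abs).pow_const 4).div_const 2
  set g₁ : PhaseSpace N → ℝ := fun x => (x.2 i₀) ^ 4 / 2 with hg₁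
  have hg₁m : Measurable g₁ := (((measurable_pi_apply i₀).comp measurable_snd).pow_const 4).div_const 2
  -- the bad event (the empty static part keeps the shape of `measure_bad_le`)
  set BAD : Set (PhaseSpace N × WienerPair) := (Prod.fst ⁻¹' (∅ : Set (PhaseSpace N)) ∪ E) ∪ Θ ⁻¹' E with hBAD
  have hBADm : MeasurableSet BAD := ((measurable_fst MeasurableSet.empty).union hEm).union (hΘm hEm)
  set F : PhaseSpace N × WienerPair → ℝ≥0∞ := fun q => ENNReal.ofReal ((J' q - J q) ^ 2) with hF
  set G₁ : PhaseSpace N × WienerPair → ℝ≥0∞ := fun q =>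
    ENNReal.ofReal (d * g₁ q.1) + ENNReal.ofReal (d * g₂ (P.solMap N T T s q.1 (pairPath q.2))) with hG₁
  set G₂ : PhaseSpace N × WienerPair → ℝ≥0∞ := fun q =>
    2 * (BAD.indicator (fun _ => (1 : ℝ≥0∞)) q * ENNReal.ofReal (J' q ^ 2)) +
      2 * (BAD.indicator (fun _ => (1 : ℝ≥0∞)) q * ENNReal.ofReal (J q ^ 2)) with hG₂
  have hg₂zm : Measurable fun q : PhaseSpace N × WienerPair => g₂ (P.solMap N T T s q.1 (pairPath q.2)) := by
    have h := hg₂m.comp hzm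
    exact h
  have hG₁m : Measurable G₁ :=
    (ENNReal.measurable_ofReal.comp (measurable_const.mul (hg₁m.comp measurable_fst))).add
      (ENNReal.measurable_ofReal.comp (measurable_const.mul hg₂zm))
  have hindm : Measurable (BAD.indicator fun _ => (1 : ℝ≥0∞)) := measurable_const.indicator hBADm
  -- Step 1: pointwise domination `F ≤ G₁ + G₂`
  have hdom : ∀ q, F q ≤ G₁ q + G₂ q := by
    rintro ⟨x, ω⟩
    by_cases hq : (x, ω) ∈ BAD
    · have h1 : F (x, ω) ≤ G₂ (x, ω) := by
        simp only [hF, hG₂, Set.indicator_of_mem hq, one_mul]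
        have e : (J' (x, ω) - J (x, ω)) ^ 2 ≤ 2 * J' (x, ω) ^ 2 + 2 * J (x, ω) ^ 2 := by
          nlinarith [sq_nonneg (J' (x, ω) + J (x, ω))]
        calc ENNReal.ofReal ((J' (x, ω) - J (x, ω)) ^ 2)
            ≤ ENNReal.ofReal (2 * J' (x, ω) ^ 2 + 2 * J (x, ω) ^ 2) := ENNReal.ofReal_le_ofReal e
          _ = 2 * ENNReal.ofReal (J' (x, ω) ^ 2) + 2 * ENNReal.ofReal (J (x, ω) ^ 2) := by
              rw [ENNReal.ofReal_add (by positivity) (by positivity), ENNReal.ofReal_mul (by norm_num),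
                ENNReal.ofReal_mul (by norm_num), ENNReal.ofReal_ofNat]
      exact h1.trans le_add_self
    · have hxE : (x, ω) ∉ E := fun h => hq (Or.inl (Or.inr h))
      have hx'E : (momentumFlip i₀ x, ω) ∉ E := fun h => hq (Or.inr (show Θ (x, ω) ∈ E from h))
      set η : ℝ → Fin N → ℝ := P.pairNoise N T T (pairPath ω) with hη
      have hηc : Continuous η := P.continuous_pairNoise N T T (pairPath ω)
      have hsol : ∀ (y : PhaseSpace N) (u : ℝ), P.solMap N T T u y (pairPath ω) = P.chainFlow N y η u :=
        fun _ _ => rfl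
      have hboxω : ∀ r ∈ Set.Icc 0 τ, ∀ j j' : Fin N, (((j' : ℕ) : ℤ) - j).natAbs ≤ 1 →
          (P.chainFlow N x η r).1 j' ^ 2 ≤ ρ ^ 2 * Real.sqrt (1 + ((((j : ℕ) : ℤ) - i₀).natAbs : ℝ)) ∧
          (P.chainFlow N (momentumFlip i₀ x) η r).1 j' ^ 2 ≤ ρ ^ 2 * Real.sqrt (1 + ((((j : ℕ) : ℤ) - i₀).natAbs : ℝ)) :=
        fun r hr j j' hjj' => ⟨by rw [← hsol]; exact hbox (x, ω) hxE r hr j j' hjj',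
          by rw [← hsol]; exact hbox (momentumFlip i₀ x, ω) hx'E r hr j j' hjj'⟩
      have hsI : (s : ℝ) ∈ Set.Icc 0 τ := ⟨s.2, hs⟩
      have main : (P.bondCurrent N k (P.chainFlow N (momentumFlip i₀ x) η s) - P.bondCurrent N k (P.chainFlow N x η s)) ^ 2 ≤
          d * ((x.2 i₀) ^ 2 * (1 + |(P.chainFlow N x η s).2 k| + |(P.chainFlow N x η s).2 k1|) ^ 2) :=
        sq_bondCurrent_diff_le_weighted hω hl.le hβ.le hγ.le i₀ k hk hD1 hDk hDk1 x hηc hρ hreg hboxω hsI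
      have hW : d * ((x.2 i₀) ^ 2 * (1 + |(P.chainFlow N x η s).2 k| + |(P.chainFlow N x η s).2 k1|) ^ 2) ≤
          d * g₁ x + d * g₂ (P.chainFlow N x η s) := by
        simp only [hg₁, hg₂]
        rw [← mul_add]
        refine mul_le_mul_of_nonneg_left ?_ hd0
        set S' := 1 + |(P.chainFlow N x η s).2 k| + |(P.chainFlow N x η s).2 k1|
        nlinarith [sq_nonneg ((x.2 i₀) ^ 2 - S' ^ 2)]
      have hreal : (J' (x, ω) - J (x, ω)) ^ 2 ≤ d * g₁ x + d * g₂ (P.solMap N T T s x (pairPath ω)) := by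
        simp only [hJ, hJ']
        rw [hsol x s, hsol (momentumFlip i₀ x) s]
        exact main.trans hW
      have h1 : F (x, ω) ≤ G₁ (x, ω) := by
        simp only [hF, hG₁]
        calc ENNReal.ofReal ((J' (x, ω) - J (x, ω)) ^ 2)
            ≤ ENNReal.ofReal (d * g₁ x + d * g₂ (P.solMap N T T s x (pairPath ω))) := ENNReal.ofReal_le_ofReal hreal
          _ ≤ ENNReal.ofReal (d * g₁ x) + ENNReal.ofReal (d * g₂ (P.solMap N T T s x (pairPath ω))) :=
              ENNReal.ofReal_add_le
      exact h1.trans le_self_add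
  -- Step 2: integrate
  set π : Measure (PhaseSpace N × WienerPair) := μ.prod wienerPair with hπ
  haveI hπP : IsProbabilityMeasure π := by rw [hπ]; infer_instance
  have hFm : Measurable F := ENNReal.measurable_ofReal.comp ((hJ'm.sub hJm).pow_const 2)
  have hsplit : ∫⁻ x, ∫⁻ ω, F (x, ω) ∂wienerPair ∂μ ≤ ∫⁻ q, G₁ q ∂π + ∫⁻ q, G₂ q ∂π := by
    calc ∫⁻ x, ∫⁻ ω, F (x, ω) ∂wienerPair ∂μ = ∫⁻ q, F q ∂π := (lintegral_prod F hFm.aemeasurable).symm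
      _ ≤ ∫⁻ q, (G₁ q + G₂ q) ∂π := lintegral_mono hdom
      _ = ∫⁻ q, G₁ q ∂π + ∫⁻ q, G₂ q ∂π := lintegral_add_left hG₁m _
  -- Step 3: the two terms
  have hT1 : ∫⁻ q, G₁ q ∂π ≤ ENNReal.ofReal (d * (195 * T ^ 2 + 32)) :=
    lintegral_weight_le hω hl hβ hγ hT hN0 i₀ k k1 hd0 s
  have hπBAD : π BAD ≤ ENNReal.ofReal (0 + 2 * b) :=
    measure_bad_le P N T i₀ MeasurableSet.empty hEm le_rfl hb (by rw [measure_empty]; exact bot_le) hEπ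
  rw [zero_add] at hπBAD
  have h44 := lintegral_current_four_le hω hl hβ hγ hT hN0 i₀ k hD2 s
  have hT2 : ∫⁻ q, G₂ q ∂π ≤ ENNReal.ofReal (4 * Real.sqrt (C₄ * (2 * b))) := by
    have hm1 : Measurable fun q => BAD.indicator (fun _ => (1 : ℝ≥0∞)) q * ENNReal.ofReal (J' q ^ 2) :=
      hindm.mul (ENNReal.measurable_ofReal.comp (hJ'm.pow_const 2))
    have hm2 : Measurable fun q => BAD.indicator (fun _ => (1 : ℝ≥0∞)) q * ENNReal.ofReal (J q ^ 2) :=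
      hindm.mul (ENNReal.measurable_ofReal.comp (hJm.pow_const 2))
    have hb2 : 0 ≤ 2 * b := by positivity
    have hH1 := lintegral_indicator_sq_le_sqrt π hJ'm hBADm hC₄ hb2 h44.2 hπBAD
    have hH2 := lintegral_indicator_sq_le_sqrt π hJm hBADm hC₄ hb2 h44.1 hπBAD
    calc ∫⁻ q, G₂ q ∂π = 2 * ∫⁻ q, BAD.indicator (fun _ => (1 : ℝ≥0∞)) q * ENNReal.ofReal (J' q ^ 2) ∂π +
          2 * ∫⁻ q, BAD.indicator (fun _ => (1 : ℝ≥0∞)) q * ENNReal.ofReal (J q ^ 2) ∂π := by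
          simp only [hG₂]
          rw [lintegral_add_left (hm1.const_mul 2), lintegral_const_mul 2 hm1, lintegral_const_mul 2 hm2]
      _ ≤ 2 * ENNReal.ofReal (Real.sqrt (C₄ * (2 * b))) + 2 * ENNReal.ofReal (Real.sqrt (C₄ * (2 * b))) :=
          add_le_add (mul_le_mul' le_rfl hH1) (mul_le_mul' le_rfl hH2)
      _ = ENNReal.ofReal (4 * Real.sqrt (C₄ * (2 * b))) := by
          rw [← two_mul, ← mul_assoc, ← ENNReal.ofReal_ofNat 2, ← ENNReal.ofReal_mul (by norm_num),
            ← ENNReal.ofReal_mul (by norm_num)]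
          congr 1; ring
  calc ∫⁻ x, ∫⁻ ω, F (x, ω) ∂wienerPair ∂μ ≤ ∫⁻ q, G₁ q ∂π + ∫⁻ q, G₂ q ∂π := hsplit
    _ ≤ ENNReal.ofReal (d * (195 * T ^ 2 + 32)) + ENNReal.ofReal (4 * Real.sqrt (C₄ * (2 * b))) := add_le_add hT1 hT2

end SingleFlip

open SingleFlip in
/-- **Registered helper `pinnedChain_singleFlip_weighted_estimate`** (fixed-`N` core of stub (C′)
`stub_uniformAnchoredCorrelationTails`, line `series-law-at-every-laplace-frequency`): the weighted single-flip estimate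
of the synchronous coupling of the open pinned chain — given a scale `ρ ≥ 1` in the light-cone regime for all distances
`n ≥ D`, a measurable exceptional set of the stationary law `μ_T ⊗ W` of measure `≤ b` off which the weighted position
box `q² ≤ ρ²√(1+|j−i₀|)` holds on `[0, τ]`, and `∫ j_k⁴ dμ_T ≤ C₄`, the pathwise mean square of `j_k` along the two
flows from `x` and from `x` with `p_{i₀}` flipped (bond `(k,k+1)` at distance `≥ D ≥ 1` from `i₀`) is at most
`28224(1+β)²ρ⁶(9/16)^D(195T²+32) + 4√(C₄·2b)` for every `s ≤ τ`. [folklore] -/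
theorem pinnedChain_singleFlip_weighted_estimate :
    ∀ ω₂ lam β γ : ℝ, 0 < ω₂ → 0 < lam → 0 < β → 0 < γ → ∀ T : ℝ, 0 < T →
      ∀ (N : ℕ) (i₀ k : Fin N) (hk : (k : ℕ) + 1 < N) (D : ℕ), 1 ≤ D →
        D ≤ ((k : ℤ) - i₀).natAbs → D ≤ ((k : ℤ) + 1 - i₀).natAbs → ∀ (ρ τ : ℝ), 1 ≤ ρ →
        (∀ n : ℕ, D ≤ n →
          2 * Real.exp 1 * (3 * ((3 + ω₂ + 3 * lam + 24 * β + 2 * γ) * ρ ^ 2) * Real.sqrt (1 + ((2 * n : ℕ) : ℝ)) * τ) ≤ n) →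
        ∀ (E : Set (Literature.MathematicalPhysics.KineticTheory.HeatConduction.PhaseSpace N × Literature.Probability.Process.WienerPair)), MeasurableSet E → ∀ b : ℝ, 0 ≤ b →
        (((Literature.MathematicalPhysics.KineticTheory.HeatConduction.pinnedChain ω₂ lam β γ).gibbsMeasure N T).prod Literature.Probability.Process.wienerPair) E ≤ ENNReal.ofReal b →
        (∀ q ∉ E, ∀ s ∈ Set.Icc (0:ℝ) τ, ∀ j j' : Fin N, ((j' : ℤ) - j).natAbs ≤ 1 →
          ((Literature.MathematicalPhysics.KineticTheory.HeatConduction.pinnedChain ω₂ lam β γ).solMap N T T s q.1 (Literature.Probability.Process.pairPath q.2)).1 j' ^ 2 ≤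
            ρ ^ 2 * Real.sqrt (1 + (((j : ℤ) - i₀).natAbs : ℝ))) →
        ∀ C₄ : ℝ, 0 ≤ C₄ →
        MeasureTheory.Integrable (fun x => (Literature.MathematicalPhysics.KineticTheory.HeatConduction.pinnedChain ω₂ lam β γ).bondCurrent N k x ^ 4)
            ((Literature.MathematicalPhysics.KineticTheory.HeatConduction.pinnedChain ω₂ lam β γ).gibbsMeasure N T) →
        ∫ x, (Literature.MathematicalPhysics.KineticTheory.HeatConduction.pinnedChain ω₂ lam β γ).bondCurrent N k x ^ 4 ∂((Literature.MathematicalPhysics.KineticTheory.HeatConduction.pinnedChain ω₂ lam β γ).gibbsMeasure N T) ≤ C₄ →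
        ∀ s : NNReal, (s : ℝ) ≤ τ →
          ∫⁻ x, ∫⁻ ω, ENNReal.ofReal
              (((Literature.MathematicalPhysics.KineticTheory.HeatConduction.pinnedChain ω₂ lam β γ).bondCurrent N k
                  ((Literature.MathematicalPhysics.KineticTheory.HeatConduction.pinnedChain ω₂ lam β γ).solMap N T T s (Literature.MathematicalPhysics.KineticTheory.HeatConduction.momentumFlip i₀ x) (Literature.Probability.Process.pairPath ω)) -
                (Literature.MathematicalPhysics.KineticTheory.HeatConduction.pinnedChain ω₂ lam β γ).bondCurrent N k
                  ((Literature.MathematicalPhysics.KineticTheory.HeatConduction.pinnedChain ω₂ lam β γ).solMap N T T s x (Literature.Probability.Process.pairPath ω))) ^ 2)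
              ∂Literature.Probability.Process.wienerPair ∂((Literature.MathematicalPhysics.KineticTheory.HeatConduction.pinnedChain ω₂ lam β γ).gibbsMeasure N T) ≤
            ENNReal.ofReal (28224 * (1 + β) ^ 2 * ρ ^ 6 * (9 / 16) ^ D * (195 * T ^ 2 + 32)) +
              ENNReal.ofReal (4 * Real.sqrt (C₄ * (2 * b))) :=
  fun _ _ _ _ hω hl hβ hγ _ hT _ i₀ k hk _ hD1 hDk hDk1 _ _ hρ hreg E hEm _ hb hEπ hbox _ hC₄ hI hI4 s hs =>
    single_flip_weighted hω hl hβ hγ hT i₀ k hk hD1 hDk hDk1 hρ hreg E hEm hb hEπ hbox hC₄ ⟨hI, hI4⟩ s hs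

end Summit.AtomisticToContinuum.FouriersLaw.Theorems.AbelThermodynamicLimit.SeriesLawAtEveryLaplaceFrequency

end
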